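import Summits.SmoothPoincare4.SmoothPoincare4.Theorems.ConvexBisectionPlanarAcyclicBisectionExistsSupport
import Summits.SmoothPoincare4.SmoothPoincare4.Theorems.AcyclicBisectionExists.Negative.Doubles
import Literature.Geometry.Symplectic.SphereOpenBook

/-!
# `PlanarAcyclicBisectionExists` — support: the round `S⁴` and the kill criterion UNCONDITIONALLY;
# doubles; the load-bearing hypothesis

Sequel of `Theorems/ConvexBisectionPlanarAcyclicBisectionExistsSupport.lean` for the item
`Summit.SmoothPoincare4.SmoothPoincare4.Theses.ConvexBisection.PlanarAcyclicBisectionExists`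
(stmt-SmoothPoincare4-15088, support rank 9 of route ConvexBisection).  The planarity of the standard
contact sphere `(S³, ξ_std) = ∂(𝔻⁴, J₀, |z|²)` is now a tree theorem —
`Literature.Geometry.Symplectic.planarContactBoundary_steinStructureClosedBall` (the disc open book
of `S³`, `Literature/Geometry/Symplectic/SphereOpenBook.lean`) — so the hypothesis
`hP : PlanarContactBoundary steinStructureClosedBall` of the sibling support files is DISCHARGED:

* §1 `exists_acyclic_planar_sphere` — NON-VACUITY: the round `S⁴` carries a ℚ-acyclic Stein
  bisection along a common contact seam with planar first half (hemispheres = two standard Stein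
  balls); `planarAcyclicBisectionExists_of_smoothPoincare4` — KILL CRITERION
  `SmoothPoincare4 → PlanarAcyclicBisectionExists`; `not_smoothPoincare4_of_not_planarAcyclicBisectionExists`,
  `exotic_of_not_planarAcyclicBisectionExists` — a refutation of the item is literally an exotic
  4-sphere; `smoothPoincare4_iff_planarAcyclic_pair` — NO SLACK in the Etnyre-free planar deciding
  pair; `planarAcyclicBisectionExists_iff_smoothPoincare4` — given the rigidity crux
  (stmt-SmoothPoincare4-15086) the item is EQUIVALENT to the summit.
* §2 the same discharge for the sibling support item `PlanarBisectionExists`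
  (stmt-SmoothPoincare4-10512): `exists_planar_connected_sphere`,
  `planarBisectionExists_of_smoothPoincare4`, `not_smoothPoincare4_of_not_planarBisectionExists`,
  `smoothPoincare4_iff_planar_pair` (unconditional forms of the `…_of hP` theorems of
  `Theorems/ConvexBisectionPlanarBisectionExistsSupport.lean` / `…PlanarPair.lean`).
* §3 further relations: `steinBisectionExists_of_planarAcyclicBisectionExists` (item ⇒ support
  10509); `smoothPoincare4_of_planarAcyclicBisectionExists_of_acyclicBisectionRigidity` (with the
  item, the route's `closes` needs only its rigidity crux 10507).
* §4 `exists_acyclic_planar_of_isDouble` — every double `D(W)` of a ℚ-acyclic compact Stein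
  domain with planar contact boundary satisfies the ∃-body (`S⁴ = D(𝔻⁴)`; `S⁴ = D(C)` for planar
  Stein corks, Karakurt–Oba–Ukida Prop 2.3: the item does not collapse to the seam-`S³` case).
* §5 `planarAcyclicBisectionExists_false_without_homotopyEquiv` — the hypothesis `M ≃ₕ S⁴` is
  load-bearing (the ∃-body is false at `M = ℝ⁴`: witnesses force compactness).
-/

noncomputable section

-- the prescribed namespace `Summit.<P>.<Sub>.…` duplicates `SmoothPoincare4` (P = Sub)
set_option linter.dupNamespace false

open scoped Manifold ContDiff Topology ContinuousMap
open Set Function CategoryTheory.Limits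
open Literature.Geometry.Symplectic Literature.Topology.FourManifolds
open Literature.AlgebraicTopology.SingularHomology

namespace Summit.SmoothPoincare4.SmoothPoincare4.Theorems.PlanarAcyclicBisectionExists

open Summit.SmoothPoincare4.SmoothPoincare4.Theses.ConvexBisection
open Summit.SmoothPoincare4.SmoothPoincare4.Theorems.AcyclicBisectionExists.Negative
open Summit.SmoothPoincare4.SmoothPoincare4.Theorems.PlanarBisectionExists

/-! ## §1 The round sphere and the kill criterion, unconditionally -/

/-- **NON-VACUITY at `S⁴` (unconditional)**: the hemisphere bisection of the round `S⁴` by two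
standard Stein balls is ℚ-acyclic (`𝔻⁴` is contractible) and its first half has planar contact
boundary (`planarContactBoundary_steinStructureClosedBall`: the disc open book of `S³` supports
`ξ_std`) — the sibling `exists_acyclic_planar_sphere_of` with its hypothesis discharged.  So the
item's signature is satisfiable in the intended way at its base point. [folklore] -/
theorem exists_acyclic_planar_sphere :
    ∃ B : Witness (Metric.sphere (0 : EuclideanSpace ℝ (Fin 5)) 1),
      B.Acyclic ∧ PlanarContactBoundary B.J₁ :=
  exists_acyclic_planar_sphere_of planarContactBoundary_steinStructureClosedBall

/-- **KILL CRITERION (unconditional): the item is implied by the summit**,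
`SmoothPoincare4 → PlanarAcyclicBisectionExists` — transport the hemisphere bisection of `S⁴`
along `M ≅ S⁴`.  So an outright refutation of the item is an exotic 4-sphere. [folklore] -/
theorem planarAcyclicBisectionExists_of_smoothPoincare4 (hs : _root_.SmoothPoincare4) :
    PlanarAcyclicBisectionExists :=
  planarAcyclicBisectionExists_of_smoothPoincare4_of planarContactBoundary_steinStructureClosedBall hs

/-- … equivalently: **`¬ PlanarAcyclicBisectionExists → ¬ SmoothPoincare4`** (unconditional).
[folklore] -/
theorem not_smoothPoincare4_of_not_planarAcyclicBisectionExists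
    (h : ¬ PlanarAcyclicBisectionExists) : ¬ _root_.SmoothPoincare4 :=
  fun hs => h (planarAcyclicBisectionExists_of_smoothPoincare4 hs)

/-- The exotic sphere extracted from a refutation: some smooth `M ≃ₕ S⁴` WITHOUT any ℚ-acyclic
planar Stein bisection along a common contact seam — in particular not diffeomorphic to `S⁴`.
[folklore] -/
theorem exotic_of_not_planarAcyclicBisectionExists (h : ¬ PlanarAcyclicBisectionExists) :
    ∃ (M : Type) (_ : TopologicalSpace M) (_ : T2Space M) (_ : SecondCountableTopology M)
      (_ : ChartedSpace (EuclideanSpace ℝ (Fin 4)) M) (_ : IsManifold (𝓡 4) ∞ M),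
      Nonempty (M ≃ₕ (Metric.sphere (0 : EuclideanSpace ℝ (Fin 5)) 1)) ∧
        (¬ ∃ B : Witness M, B.Acyclic ∧ PlanarContactBoundary B.J₁) ∧
          IsEmpty (M ≃ₘ⟮𝓡 4, 𝓡 4⟯ (Metric.sphere (0 : EuclideanSpace ℝ (Fin 5)) 1)) := by
  rw [planarAcyclicBisectionExists_iff] at h
  simp only [not_forall] at h
  obtain ⟨M, _, _, _, _, _, e, hM⟩ := h
  refine ⟨M, ‹_›, ‹_›, ‹_›, ‹_›, ‹_›, ⟨e⟩, hM, ⟨fun Φ => hM ?_⟩⟩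
  exact exists_acyclic_planar_of_diffeomorph Φ.symm exists_acyclic_planar_sphere

/-- **No slack in the Etnyre-free planar deciding pair (unconditional)**:
`SmoothPoincare4 ↔ PlanarAcyclicBisectionExists ∧ PlanarAcyclicBisectionRigidity`. [folklore] -/
theorem smoothPoincare4_iff_planarAcyclic_pair :
    _root_.SmoothPoincare4 ↔ PlanarAcyclicBisectionExists ∧ PlanarAcyclicBisectionRigidity :=
  smoothPoincare4_iff_planarAcyclic_pair_of planarContactBoundary_steinStructureClosedBall

/-- **Given the rigidity crux (stmt-SmoothPoincare4-15086), the item is EQUIVALENT to the summit**: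
on that branch it is exactly as hard as SPC4. [folklore] -/
theorem planarAcyclicBisectionExists_iff_smoothPoincare4 (hR : PlanarAcyclicBisectionRigidity) :
    PlanarAcyclicBisectionExists ↔ _root_.SmoothPoincare4 :=
  ⟨fun hE => smoothPoincare4_of_planarAcyclic_pair hE hR,
    planarAcyclicBisectionExists_of_smoothPoincare4⟩

/-! ## §2 The same discharge for the sibling support item `PlanarBisectionExists` -/

/-- **Non-vacuity of `PlanarBisectionExists` at `S⁴` (unconditional)**: the round `S⁴ = D(𝔻⁴)`
carries a Stein bisection along a common contact seam with planar first half and connected seam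
(sibling `exists_planar_connected_sphere_of`, its hypothesis discharged). [folklore] -/
theorem exists_planar_connected_sphere :
    ∃ B : Witness (Metric.sphere (0 : EuclideanSpace ℝ (Fin 5)) 1),
      PlanarContactBoundary B.J₁ ∧ IsConnected B.seam :=
  exists_planar_connected_sphere_of planarContactBoundary_steinStructureClosedBall

/-- **Kill criterion for `PlanarBisectionExists` (stmt-SmoothPoincare4-10512), unconditional**:
`SmoothPoincare4 → PlanarBisectionExists`. [folklore] -/
theorem planarBisectionExists_of_smoothPoincare4 (hs : _root_.SmoothPoincare4) :
    PlanarBisectionExists :=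
  planarBisectionExists_of_smoothPoincare4_of planarContactBoundary_steinStructureClosedBall hs

/-- `¬ PlanarBisectionExists → ¬ SmoothPoincare4` (unconditional). [folklore] -/
theorem not_smoothPoincare4_of_not_planarBisectionExists (h : ¬ PlanarBisectionExists) :
    ¬ _root_.SmoothPoincare4 :=
  not_smoothPoincare4_of_not_planarBisectionExists_of planarContactBoundary_steinStructureClosedBall h

/-- **No slack in the planar pair (unconditional)**:
`SmoothPoincare4 ↔ PlanarBisectionExists ∧ PlanarBisectionRigidity` (the planar pair of
`Theorems/ConvexBisectionPlanarBisectionExistsPlanarPair.lean` with `hP` discharged). [folklore] -/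
theorem smoothPoincare4_iff_planar_pair :
    _root_.SmoothPoincare4 ↔ PlanarBisectionExists ∧ PlanarBisectionRigidity := by
  refine ⟨fun hs => ⟨planarBisectionExists_of_smoothPoincare4 hs, fun M _ _ _ _ _ e _ =>
    hs M ‹_› ‹_› e⟩, fun h M _ _ _ _ _ e => ?_⟩
  obtain ⟨B, hP, -⟩ := planarBisectionExists_iff.1 h.1 M e
  exact h.2 M e ⟨B.W₁, inferInstance, inferInstance, inferInstance, inferInstance, B.W₂,
    inferInstance, inferInstance, inferInstance, inferInstance, B.J₁, B.J₂, B.e₁, B.e₂, B.emb₁,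
    B.emb₂, B.cover, B.inter₁, B.inter₂, B.contact, hP⟩

/-! ## §3 Further relations -/

/-- The item implies `SteinBisectionExists` (support stmt-SmoothPoincare4-10509). [folklore] -/
theorem steinBisectionExists_of_planarAcyclicBisectionExists (h : PlanarAcyclicBisectionExists) :
    SteinBisectionExists :=
  steinBisectionExists_of_planarBisectionExists
    (planarBisectionExists_of_planarAcyclicBisectionExists h)

/-- With the item, the route's deciding theorem `closes` needs only its rigidity crux
(stmt-SmoothPoincare4-10507): `PlanarAcyclicBisectionExists → AcyclicBisectionRigidity →
SmoothPoincare4`. [folklore] -/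
theorem smoothPoincare4_of_planarAcyclicBisectionExists_of_acyclicBisectionRigidity
    (hE : PlanarAcyclicBisectionExists) (hR : AcyclicBisectionRigidity) : _root_.SmoothPoincare4 :=
  closes (acyclicBisectionExists_of_planarAcyclicBisectionExists hE) hR

/-! ## §4 Doubles of ℚ-acyclic planar Stein domains -/

/-- **Doubles of ℚ-acyclic planar Stein domains satisfy the ∃-body**: if `(W, S)` is a compact
Stein domain with planar contact boundary and `H_k(W; ℚ) = 0` for `k > 0`, every double
`P = W ∪_id W̄` carries a ℚ-acyclic witness with planar first half (sibling `Witness.ofIsDouble`).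
On paper: `S⁴ = D(𝔻⁴)`, and `S⁴ = D(C)` for every planar Stein cork `C` (Mazur;
Karakurt–Oba–Ukida Prop 2.3) — the item does not collapse to the seam-`S³` case. [folklore] -/
theorem exists_acyclic_planar_of_isDouble {W : Type} [TopologicalSpace W]
    [ChartedSpace (EuclideanHalfSpace 4) W] [IsManifold (𝓡∂ 4) ∞ W] [CompactSpace W]
    (b : BoundaryData (𝓡∂ 4) W (𝓡 3)) (S : SteinStructure W) (hS : PlanarContactBoundary S)
    (hW : ∀ k, 0 < k → IsZero (singularHomology ℚ ℚ W k)) {P : Type} [TopologicalSpace P]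
    [ChartedSpace (EuclideanSpace ℝ (Fin 4)) P] (hD : IsDouble b (𝓡 4) P) :
    ∃ B : Witness P, B.Acyclic ∧ PlanarContactBoundary B.J₁ :=
  ⟨Witness.ofIsDouble b S hD, fun k hk => ⟨hW k hk, hW k hk⟩, hS⟩

/-! ## §5 The homotopy-sphere hypothesis is load-bearing -/

/-- **Any proof must use `M ≃ₕ S⁴`** (at least its consequence `CompactSpace M`): the ∃-body of
the item fails at `M = ℝ⁴`, since every witness forces `M` to be compact
(`Witness.compactSpace`). [folklore] -/
theorem planarAcyclicBisectionExists_false_without_homotopyEquiv :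
    ¬ ∀ (M : Type) [TopologicalSpace M] [T2Space M] [SecondCountableTopology M]
      [ChartedSpace (EuclideanSpace ℝ (Fin 4)) M] [IsManifold (𝓡 4) ∞ M],
      ∃ B : Witness M, B.Acyclic ∧ PlanarContactBoundary B.J₁ := by
  intro h
  obtain ⟨B, -, -⟩ := h (EuclideanSpace ℝ (Fin 4))
  exact (not_compactSpace_iff.2 (inferInstance : NoncompactSpace (EuclideanSpace ℝ (Fin 4))))
    B.compactSpace

end Summit.SmoothPoincare4.SmoothPoincare4.Theorems.PlanarAcyclicBisectionExists
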